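import Literature.Analysis.OperatorTheory.PositiveKernelTransferOperator
import HarnessLib

/-!
# Positivity and measurability of kernel-section pairings `u ↦ ⟪φ, k_u⟫`

Topic `Literature/Analysis/OperatorTheory`; companion of `PositiveKernelTransferOperator.lean` (the
kernel sections `k_u = K(u, ·) ∈ L²(μ)` of a bounded jointly measurable kernel on a finite measure
space and the integral operators `(Aφ)(x) = ∫ K(x,y) φ(y) dμ`) and `PowerIterationRatioLimit.lean`
(boundary-independence of transfer-operator ratios on the sets `{u : ⟪φ, k_u⟫ ≥ δ}`). Everything
here is PROVED (Mathlib + `PositiveKernelTransferOperator`; no definitions):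

* `integral_pos_of_ae_pos` — an integrable, a.e. strictly positive function on a nonzero measure has
  strictly positive integral;
* `measurable_inner_kernel_section` — `u ↦ ⟪φ, k_u⟫ = ∫ φ(y) K(u,y) dμ(y)` is measurable;
* `inner_kernel_section_pos` — it is strictly positive everywhere when `K > 0` and `φ > 0` a.e.;
* `inner_kernelOp_self_pos` — `⟪φ, Mφ⟫ > 0` for the integral operator `M` of a strictly positive
  bounded kernel and an a.e. strictly positive `φ ∈ L²`.

These make the exhausting sets `{⟪φ, k_u⟫ ≥ δ}`, `δ ↓ 0`, of the uniqueness argument for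
one-dimensional chains measurable and exhausting, and supply the hypothesis `0 < ⟪φ, M₁ φ⟫` of
`exists_forall_abs_ratio_sub_lt`. [folklore]
-/

noncomputable section

open MeasureTheory Set Filter Function
open scoped RealInnerProductSpace ENNReal

namespace Literature.Analysis.OperatorTheory

/-- An integrable function which is a.e. strictly positive on a nonzero measure has a strictly
positive integral. [folklore] -/
theorem integral_pos_of_ae_pos {α : Type*} [MeasurableSpace α] {μ : Measure α} (hμ : μ ≠ 0)
    {f : α → ℝ} (hf : Integrable f μ) (hpos : ∀ᵐ x ∂μ, 0 < f x) : 0 < ∫ x, f x ∂μ := by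
  rw [integral_pos_iff_support_of_nonneg_ae (hpos.mono fun x hx => hx.le) hf, pos_iff_ne_zero]
  intro h0
  have h1 : ∀ᵐ x ∂μ, x ∉ Function.support f := measure_eq_zero_iff_ae_notMem.1 h0
  have h2 : ∀ᵐ x ∂μ, False := by
    filter_upwards [h1, hpos] with x hx hx'
    exact hx (Function.mem_support.2 hx'.ne')
  exact hμ (ae_eq_bot.1 (eventually_false_iff_eq_bot.1 h2))

variable {X : Type*} [MeasurableSpace X] {μ : Measure X} [IsFiniteMeasure μ]
  {K : X → X → ℝ} {C : ℝ}

/-- **`u ↦ ⟪φ, k_u⟫` is measurable** (`k_u = K(u, ·)`, `K` bounded and jointly measurable,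
`φ ∈ L²`). [folklore] -/
theorem measurable_inner_kernel_section (hK : StronglyMeasurable (uncurry K))
    (hC : ∀ x y, ‖K x y‖ ≤ C) (φ : Lp ℝ 2 μ) :
    Measurable fun u => ⟪φ, (memLp_kernel_section (μ := μ) hK hC u).toLp (K u)⟫ := by
  -- replace `φ` by a strongly measurable representative
  set φ' : X → ℝ := (Lp.aestronglyMeasurable φ).mk φ with hφ'
  have hφ'm : StronglyMeasurable φ' := (Lp.aestronglyMeasurable φ).stronglyMeasurable_mk
  have hae : (φ : X → ℝ) =ᵐ[μ] φ' := (Lp.aestronglyMeasurable φ).ae_eq_mk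
  have heq : (fun u => ⟪φ, (memLp_kernel_section (μ := μ) hK hC u).toLp (K u)⟫) =
      fun u => ∫ y, φ' y * K u y ∂μ := by
    funext u
    rw [inner_kernel_section hK hC φ u]
    exact integral_congr_ae (by filter_upwards [hae] with y hy; rw [hy])
  rw [heq]
  have hjoint : StronglyMeasurable (uncurry fun (u : X) (y : X) => φ' y * K u y) :=
    (hφ'm.comp_measurable measurable_snd).mul hK
  exact hjoint.integral_prod_right'.measurable

/-- **`⟪φ, k_u⟫ > 0` for every `u`** when the kernel is strictly positive and `φ > 0` a.e. on a
nonzero measure. [folklore] -/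
theorem inner_kernel_section_pos (hK : StronglyMeasurable (uncurry K)) (hC : ∀ x y, ‖K x y‖ ≤ C)
    (hpos : ∀ x y, 0 < K x y) (hμ : μ ≠ 0) {φ : Lp ℝ 2 μ} (hφ : ∀ᵐ x ∂μ, 0 < φ x) (u : X) :
    0 < ⟪φ, (memLp_kernel_section (μ := μ) hK hC u).toLp (K u)⟫ := by
  rw [inner_kernel_section hK hC φ u]
  have hint : Integrable (fun y => φ y * K u y) μ := by
    have h := integrable_kernel_mul_coeFn hK hC φ u
    exact h.congr (Eventually.of_forall fun y => mul_comm _ _)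
  exact integral_pos_of_ae_pos hμ hint (hφ.mono fun y hy => mul_pos hy (hpos u y))

variable {A : Lp ℝ 2 μ →L[ℝ] Lp ℝ 2 μ}

/-- **`⟪φ, Mφ⟫ > 0`** for the integral operator of a strictly positive bounded kernel and an a.e.
strictly positive `φ ∈ L²` of a nonzero finite measure. [folklore] -/
theorem inner_kernelOp_self_pos (hK : StronglyMeasurable (uncurry K)) (hC : ∀ x y, ‖K x y‖ ≤ C)
    (hpos : ∀ x y, 0 < K x y) (hμ : μ ≠ 0)
    (hA : ∀ ψ : Lp ℝ 2 μ, (A ψ : X → ℝ) =ᵐ[μ] fun x => ∫ y, K x y * ψ y ∂μ)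
    {φ : Lp ℝ 2 μ} (hφ : ∀ᵐ x ∂μ, 0 < φ x) : 0 < ⟪φ, A φ⟫ := by
  rw [inner_kernelOp_eq_integral hA φ φ]
  have hC0 : 0 ≤ C := by
    obtain ⟨x, -⟩ := nonempty_of_measure_ne_zero (fun h => hμ (Measure.measure_univ_eq_zero.1 h))
    exact (norm_nonneg _).trans (hC x x)
  -- the inner integral is everywhere positive, bounded and (after choosing a representative) measurable
  set φ' : X → ℝ := (Lp.aestronglyMeasurable φ).mk φ with hφ'
  have hφ'm : StronglyMeasurable φ' := (Lp.aestronglyMeasurable φ).stronglyMeasurable_mk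
  have hae : (φ : X → ℝ) =ᵐ[μ] φ' := (Lp.aestronglyMeasurable φ).ae_eq_mk
  have hG : (fun x => ∫ y, K x y * φ y ∂μ) = fun x => ∫ y, K x y * φ' y ∂μ := by
    funext x
    exact integral_congr_ae (by filter_upwards [hae] with y hy; rw [hy])
  have hGm : StronglyMeasurable fun x => ∫ y, K x y * φ y ∂μ := by
    rw [hG]
    exact (hK.mul (hφ'm.comp_measurable measurable_snd)).integral_prod_right'
  have hGpos : ∀ x, 0 < ∫ y, K x y * φ y ∂μ := fun x =>
    integral_pos_of_ae_pos hμ (integrable_kernel_mul_coeFn hK hC φ x)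
      (hφ.mono fun y hy => mul_pos (hpos x y) hy)
  have hGb : ∀ x, ‖∫ y, K x y * φ y ∂μ‖ ≤ C * Real.sqrt (μ.real univ) * ‖φ‖ := fun x => by
    rw [Real.norm_eq_abs]; exact abs_integral_kernel_mul_le hC hC0 φ x
  have hint : Integrable (fun x => φ x * ∫ y, K x y * φ y ∂μ) μ := by
    have h := ((Lp.memLp φ).integrable one_le_two).bdd_mul hGm.aestronglyMeasurable
      (Eventually.of_forall hGb)
    exact h.congr (Eventually.of_forall fun x => mul_comm _ _)
  exact integral_pos_of_ae_pos hμ hint (hφ.mono fun x hx => mul_pos hx (hGpos x))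

end Literature.Analysis.OperatorTheory

end
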